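import Mathlib
import HarnessLib
import HarnessLib.Audit
import Summits.ValiantsHypothesis.ValiantsHypothesis.Theorems.LacunarySymmetroidMatrixDescartesBinomialLead

/-!
# ValiantsHypothesis / LacunarySymmetroid — crux `MatrixDescartes` (stmt-ValiantsHypothesis-18050, V1), LINE (A) «product_plus_one»:
# the monomial cell `MonomialRowAtMostOne` (pen val-idea-25 g9 NOTE §56.9 (2); Sketch-T3-s59)

The pen's Sketch `abprobe/s59/card/Sketch-T3-s59.lean` (9314ac29748a61d5) types `MonomialRowAtMostOne` (NOTE §56.9 (2), the monomial
cell of the DIP LEMMA, «proved on paper, not yet in Lean»): one W row `(−α, κ, γ)`, ANY `k` zero-change rows and one extra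
monomial row `X^c` ⇒ at most ONE positive critical point (Descartes allows up to `4k − 1` sign variations).  Proved here VERBATIM
(`monomialRowAtMostOne`) in the `t`-picture of module `…BinomialLead`: by `concavity_identity`, at a critical point `t` off the roots
`t²ΦΦ″ = Φ²(a(a−c)M − Σ_j (tg_j′/g_j)²)`; the monomial row (`X^c = row a c 0 0 1`) contributes `c²`, the W row `(aw + cv)²` with
`w = κt^a/|g_W| ≥ 0`, `v = γt^c/|g_W| > 0`, and `M = −w + Σ q_it^a/P_i`, so the bracket is `≤ a(c−a)w − (aw+cv)² − c² < 0`
(`(aw+cv)² + c² ≥ 2c(aw+cv) ≥ a(c−a)w + 2c²v`).  Hence every positive critical point is a strict local maximum of `|Φ|`, and the generic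
lemma `card_posRoots_le_one_of_deriv_pos` («`D′ > 0` at every positive root of `D` ⇒ `D` has at most one positive root») concludes.

HONEST FRAMING: exact free-standing helper; NOT P6 / T3♯ / `OneRowZeroChange k ≥ 2` / the floor law; no stub of LINE (A) is touched
(A40 unchanged, sorries 4 → 4); `MatrixDescartes` OPEN; `VP ≠ VNP` is NOT proved and nothing here bears on it.
-/

set_option linter.dupNamespace false

namespace Summit.ValiantsHypothesis.ValiantsHypothesis.Theorems.LacunarySymmetroidMatrixDescartes

namespace ZeroChange

open Polynomial Finset

/-! ## A generic root-counting lemma -/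

/-- Sign of a function just right of a zero with positive derivative. -/
private theorem pos_right_of_hasDerivAt {f : ℝ → ℝ} {x f' : ℝ} (hf : HasDerivAt f f' x) (hx : f x = 0) (hf' : 0 < f') :
    ∃ δ > 0, ∀ y, x < y → y < x + δ → 0 < f y := by
  have ht := (hasDerivAt_iff_tendsto_slope.1 hf).eventually (lt_mem_nhds hf')
  rw [eventually_nhdsWithin_iff, Metric.eventually_nhds_iff] at ht
  obtain ⟨δ, hδ, hδ'⟩ := ht
  refine ⟨δ, hδ, fun y hxy hyδ => ?_⟩
  have hy : 0 < slope f x y := hδ' (by rw [Real.dist_eq, abs_of_pos (by linarith)]; linarith) (ne_of_gt hxy)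
  rw [slope_def_field, hx, sub_zero] at hy
  exact (div_pos_iff.1 hy).elim (fun h => h.1) (fun h => absurd h.2 (not_lt.2 (by linarith)))

/-- Sign of a function just left of a zero with positive derivative. -/
private theorem neg_left_of_hasDerivAt {f : ℝ → ℝ} {x f' : ℝ} (hf : HasDerivAt f f' x) (hx : f x = 0) (hf' : 0 < f') :
    ∃ δ > 0, ∀ y, x - δ < y → y < x → f y < 0 := by
  have ht := (hasDerivAt_iff_tendsto_slope.1 hf).eventually (lt_mem_nhds hf')
  rw [eventually_nhdsWithin_iff, Metric.eventually_nhds_iff] at ht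
  obtain ⟨δ, hδ, hδ'⟩ := ht
  refine ⟨δ, hδ, fun y hxy hyx => ?_⟩
  have hy : 0 < slope f x y := hδ' (by rw [Real.dist_eq, abs_of_neg (by linarith)]; linarith) (ne_of_lt hyx)
  rw [slope_def_field, hx, sub_zero] at hy
  exact (div_pos_iff.1 hy).elim (fun h => absurd h.2 (not_lt.2 (by linarith))) (fun h => h.1)

/-- **At most one positive root**: if `D′(t) > 0` at every positive root `t` of the real polynomial `D`, then `D` has at most one
positive root (two adjacent ones would enclose a third by the intermediate value theorem). -/
theorem card_posRoots_le_one_of_deriv_pos (D : ℝ[X]) (h : ∀ t, 0 < t → D.eval t = 0 → 0 < (derivative D).eval t) :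
    (D.roots.toFinset.filter (fun t => 0 < t)).card ≤ 1 := by
  classical
  by_contra hcard
  push Not at hcard
  set F := D.roots.toFinset.filter (fun t => 0 < t) with hF
  have hD0 : D ≠ 0 := by
    intro h0; rw [hF, h0] at hcard; simp at hcard
  have hmemF : ∀ {t}, t ∈ F ↔ 0 < t ∧ D.eval t = 0 := by
    intro t; rw [hF, mem_filter, Multiset.mem_toFinset, mem_roots hD0, IsRoot.def, and_comm]
  have hFne : F.Nonempty := by rw [← Finset.card_pos]; omega
  set t₁ := F.min' hFne with ht₁
  have ht₁F : t₁ ∈ F := min'_mem F hFne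
  have hF'ne : (F.erase t₁).Nonempty := by
    rw [← Finset.card_pos, card_erase_of_mem ht₁F]; omega
  set t₂ := (F.erase t₁).min' hF'ne with ht₂
  have ht₂F' : t₂ ∈ F.erase t₁ := min'_mem _ hF'ne
  have ht₂F : t₂ ∈ F := mem_of_mem_erase ht₂F'
  have h12 : t₁ < t₂ := lt_of_le_of_ne (min'_le F t₂ ht₂F) (ne_of_mem_erase ht₂F').symm
  have hgap : ∀ r, r ∈ F → t₁ < r → t₂ ≤ r := fun r hr h1r =>
    min'_le _ r (mem_erase.2 ⟨ne_of_gt h1r, hr⟩)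
  obtain ⟨h1pos, h1root⟩ := hmemF.1 ht₁F
  obtain ⟨h2pos, h2root⟩ := hmemF.1 ht₂F
  obtain ⟨δ₁, hδ₁, hright⟩ := pos_right_of_hasDerivAt (D.hasDerivAt t₁) h1root (h t₁ h1pos h1root)
  obtain ⟨δ₂, hδ₂, hleft⟩ := neg_left_of_hasDerivAt (D.hasDerivAt t₂) h2root (h t₂ h2pos h2root)
  set u₁ := min (t₁ + δ₁ / 2) ((t₁ + t₂) / 2) with hu₁
  set u₂ := max (t₂ - δ₂ / 2) ((t₁ + t₂) / 2) with hu₂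
  have hu₁gt : t₁ < u₁ := lt_min (by linarith) (by linarith)
  have hu₂lt : u₂ < t₂ := max_lt (by linarith) (by linarith)
  have hu12 : u₁ ≤ u₂ := (min_le_right _ _).trans (le_max_right _ _)
  have hpos₁ : 0 < D.eval u₁ := hright u₁ hu₁gt (lt_of_le_of_lt (min_le_left _ _) (by linarith))
  have hneg₂ : D.eval u₂ < 0 := hleft u₂ (lt_of_lt_of_le (by linarith) (le_max_left _ _)) hu₂lt
  obtain ⟨r, hr, hr0⟩ : ∃ r ∈ Set.Icc u₁ u₂, D.eval r = 0 :=
    intermediate_value_Icc' hu12 D.continuousOn_aeval ⟨hneg₂.le, hpos₁.le⟩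
  have hrF : r ∈ F := hmemF.2 ⟨h1pos.trans (hu₁gt.trans_le hr.1), hr0⟩
  have := hgap r hrF (hu₁gt.trans_le hr.1)
  linarith [hr.2]

/-! ## The monomial cell -/

/-- `X^c` is the row `(0, 0, 1)`. -/
theorem row_zero_zero_one (a c : ℕ) : row a c 0 0 1 = X ^ c := by simp [row]

/-- **MONOMIAL CELL (NOTE §56.9 (2)) — the pen g9 Sketch-T3-s59 `MonomialRowAtMostOne`, VERBATIM**: one W row `(−α, κ, γ)`, any `k`
zero-change rows and one extra monomial row `X^c` have at most ONE positive critical point. -/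
theorem monomialRowAtMostOne : ∀ (k a c : ℕ), 0 < a → a < c → ∀ (α κ γ : ℝ) (p q s : Fin k → ℝ),
    0 < α → 0 ≤ κ → 0 < γ → (∀ i, 0 < p i ∧ 0 ≤ q i ∧ 0 ≤ s i) →
    posCrit (row a c (-α) κ γ * X ^ c * ∏ i, row a c (p i) (q i) (s i)) ≤ 1 := by
  intro k a c ha hac α κ γ p q s hα hκ hγ h
  classical
  have hc : 0 < c := ha.trans hac
  -- the company as a `Fin (k+2)`-indexed product: W, monomial, zero-change rows
  set co : Fin (k + 2) → ℝ × ℝ × ℝ :=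
    Fin.cons ((-α, κ, γ) : ℝ × ℝ × ℝ) (Fin.cons ((0, 0, 1) : ℝ × ℝ × ℝ) (fun i => (p i, q i, s i))) with hco
  set Φ : ℝ[X] := row a c (-α) κ γ * X ^ c * ∏ i, row a c (p i) (q i) (s i) with hΦ
  have hΦco : Φ = ∏ j, row a c (co j).1 (co j).2.1 (co j).2.2 := by
    rw [hΦ, Fin.prod_univ_succ, Fin.prod_univ_succ]
    simp [hco, row_zero_zero_one, mul_assoc]
  -- the zero-change block
  set B : ℝ[X] := ∏ i, row a c (p i) (q i) (s i) with hB
  have hBpos : ∀ t, 0 < t → 0 < B.eval t := by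
    intro t ht
    rw [hB, eval_prod]
    exact prod_pos fun i _ => eval_row_pos' (h i).1 (h i).2.1 (h i).2.2 ht
  -- the tail `X^c · B` has nonnegative coefficients, hence a nonnegative derivative on (0,∞)
  have hCcoef : ∀ n, 0 ≤ (X ^ c * B).coeff n := by
    have hB' : ∀ n, 0 ≤ B.coeff n :=
      coeff_nonneg_prod _ _ (fun i _ n => coeff_row_nonneg (h i).1.le (h i).2.1 (h i).2.2 n)
    intro n
    rw [mul_comm, coeff_mul_X_pow']
    split_ifs
    · exact hB' _
    · exact le_rfl
  have hC'nn : ∀ t, 0 < t → 0 ≤ (derivative (X ^ c * B)).eval t := by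
    intro t ht
    rw [eval_eq_sum_range]
    exact sum_nonneg fun i _ => mul_nonneg (by rw [coeff_derivative]; exact mul_nonneg (hCcoef _) (by positivity))
      (pow_nonneg ht.le i)
  have hCpos : ∀ t, 0 < t → 0 < (X ^ c * B).eval t := by
    intro t ht; rw [eval_mul, eval_pow, eval_X]; exact mul_pos (pow_pos ht c) (hBpos t ht)
  -- the W row
  have hW : ∀ t, (row a c (-α) κ γ).eval t = -α + κ * t ^ a + γ * t ^ c := by intro t; simp [row]
  have hW' : ∀ t, t * (derivative (row a c (-α) κ γ)).eval t = (a : ℝ) * κ * t ^ a + (c : ℝ) * γ * t ^ c :=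
    fun t => mul_eval_derivative_row a c _ _ _ t
  -- every positive critical point has g_W < 0
  have hcrit_neg : ∀ t, 0 < t → (derivative Φ).eval t = 0 → (row a c (-α) κ γ).eval t < 0 := by
    intro t ht hd
    by_contra hge
    push Not at hge
    have hd' : (derivative Φ).eval t = (derivative (row a c (-α) κ γ)).eval t * (X ^ c * B).eval t +
        (row a c (-α) κ γ).eval t * (derivative (X ^ c * B)).eval t := by
      have hΦ' : Φ = row a c (-α) κ γ * (X ^ c * B) := by rw [hΦ, mul_assoc]
      rw [hΦ', derivative_mul, eval_add, eval_mul, eval_mul, eval_mul]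
    have hgW' : 0 < (derivative (row a c (-α) κ γ)).eval t := by
      have e := hW' t
      have hc' : (0 : ℝ) < c := by exact_mod_cast hc
      have h2 : 0 < (a : ℝ) * κ * t ^ a + (c : ℝ) * γ * t ^ c :=
        add_pos_of_nonneg_of_pos (by positivity) (mul_pos (mul_pos hc' hγ) (pow_pos ht c))
      nlinarith
    have : 0 < (derivative Φ).eval t := by
      rw [hd']
      nlinarith [mul_pos hgW' (hCpos t ht), mul_nonneg hge (hC'nn t ht)]
    linarith
  -- every positive critical point is a strict local maximum of |Φ| (Φ < 0 there, Φ'' > 0)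
  have hmax : ∀ t, 0 < t → (derivative Φ).eval t = 0 → 0 < (derivative (derivative Φ)).eval t := by
    intro t ht hd
    have hgW := hcrit_neg t ht hd
    have hΦt : Φ.eval t < 0 := by
      rw [hΦ, mul_assoc, eval_mul]; exact mul_neg_of_neg_of_pos hgW (hCpos t ht)
    have hΦne : (∏ j, row a c (co j).1 (co j).2.1 (co j).2.2).eval t ≠ 0 := by rw [← hΦco]; exact hΦt.ne
    have hd' : (derivative (∏ j, row a c (co j).1 (co j).2.1 (co j).2.2)).eval t = 0 := by rw [← hΦco]; exact hd
    have hid := concavity_identity (k + 2) a c co ht hΦne hd'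
    rw [← hΦco] at hid
    -- unfold M and the sum of squares over the company W, X^c, rows
    have hM : middleSum a c co t = κ * t ^ a / (row a c (-α) κ γ).eval t +
        ∑ i, q i * t ^ a / (row a c (p i) (q i) (s i)).eval t := by
      rw [middleSum, Fin.sum_univ_succ, Fin.sum_univ_succ]
      simp only [hco, Fin.cons_zero, Fin.cons_succ, zero_mul, zero_div, zero_add]
    have hS : ∑ j : Fin (k + 2), (t * (derivative (row a c (co j).1 (co j).2.1 (co j).2.2)).eval t /
        (row a c (co j).1 (co j).2.1 (co j).2.2).eval t) ^ 2 =
        (((a : ℝ) * κ * t ^ a + (c : ℝ) * γ * t ^ c) / (row a c (-α) κ γ).eval t) ^ 2 + (c : ℝ) ^ 2 +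
        ∑ i, (t * (derivative (row a c (p i) (q i) (s i))).eval t / (row a c (p i) (q i) (s i)).eval t) ^ 2 := by
      rw [Fin.sum_univ_succ, Fin.sum_univ_succ]
      simp only [hco, Fin.cons_zero, Fin.cons_succ]
      have hmono : t * (derivative (row a c 0 0 1)).eval t / (row a c 0 0 1).eval t = c := by
        rw [mul_eval_derivative_row, row_zero_zero_one, eval_pow, eval_X]
        have : t ^ c ≠ 0 := pow_ne_zero c ht.ne'
        field_simp; ring
      rw [hW' t, hmono, add_assoc]
    -- the bracket is negative
    have hQnn : 0 ≤ ∑ i, q i * t ^ a / (row a c (p i) (q i) (s i)).eval t :=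
      sum_nonneg fun i _ => div_nonneg (mul_nonneg (h i).2.1 (pow_nonneg ht.le a)) (eval_row_pos' (h i).1 (h i).2.1 (h i).2.2 ht).le
    have hSnn : 0 ≤ ∑ i, (t * (derivative (row a c (p i) (q i) (s i))).eval t / (row a c (p i) (q i) (s i)).eval t) ^ 2 :=
      sum_nonneg fun i _ => sq_nonneg _
    set G : ℝ := (row a c (-α) κ γ).eval t with hG
    set w : ℝ := κ * t ^ a / (-G) with hw
    set v : ℝ := γ * t ^ c / (-G) with hv
    have hGpos : 0 < -G := by rw [hG]; linarith
    have hGne : G ≠ 0 := by intro h0; rw [h0, neg_zero] at hGpos; exact lt_irrefl _ hGpos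
    have hw0 : 0 ≤ w := div_nonneg (mul_nonneg hκ (pow_nonneg ht.le a)) hGpos.le
    have hv0 : 0 < v := div_pos (mul_pos hγ (pow_pos ht c)) hGpos
    have e1 : κ * t ^ a / G = -w := by rw [hw, div_neg, neg_neg]
    have e2 : ((a : ℝ) * κ * t ^ a + (c : ℝ) * γ * t ^ c) / G = -((a : ℝ) * w + c * v) := by
      rw [hw, hv]; field_simp; ring
    have ha' : (0 : ℝ) < a := by exact_mod_cast ha
    have hac' : (a : ℝ) < c := by exact_mod_cast hac
    have hbracket : (a : ℝ) * ((a : ℝ) - c) * middleSum a c co t -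
        ∑ j : Fin (k + 2), (t * (derivative (row a c (co j).1 (co j).2.1 (co j).2.2)).eval t /
          (row a c (co j).1 (co j).2.1 (co j).2.2).eval t) ^ 2 < 0 := by
      rw [hM, hS, e1, e2]
      nlinarith [sq_nonneg ((a : ℝ) * w + c * v - c), mul_nonneg (mul_nonneg ha'.le (sub_nonneg.2 hac'.le)) hQnn,
        mul_nonneg ha'.le hw0, mul_pos (mul_pos (by positivity : (0:ℝ) < c) (by positivity : (0:ℝ) < c)) hv0,
        mul_nonneg (mul_nonneg ha'.le (by positivity : (0:ℝ) ≤ c)) hw0]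
    have hΦ2 : 0 < (Φ.eval t) ^ 2 := by have := hΦt.ne; positivity
    have ht2 : 0 < t ^ 2 := by positivity
    have hneg : t ^ 2 * (Φ.eval t * (derivative (derivative Φ)).eval t) < 0 := by
      rw [hid]; exact mul_neg_of_pos_of_neg hΦ2 hbracket
    have hΦΦ : Φ.eval t * (derivative (derivative Φ)).eval t < 0 := by
      by_contra hge; push Not at hge; exact absurd hneg (not_lt.2 (mul_nonneg ht2.le hge))
    nlinarith
  -- conclude with the generic lemma
  rw [posCrit]
  exact card_posRoots_le_one_of_deriv_pos _ hmax

end ZeroChange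

end Summit.ValiantsHypothesis.ValiantsHypothesis.Theorems.LacunarySymmetroidMatrixDescartes
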